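import Summits.Ventures.PercRepro.S1RowTwelve
import Summits.Ventures.PercRepro.S1TriangleFive
import Summits.Ventures.PercRepro.S1CellTwelveSixUncond

/-!
# PercRepro — S1 ROW 12 MODULO ONE CAP: `s₄ ≤ 32` AT NULLITY `5` (p2, gen 19; SUBCLAIM-S1 §3 / §6.4)

The row `p = 12` of the `q = 4` window rests on its two capped cells `(12, 5)` and `(12, 6)` (S1RowTwelve:
`c025_four_twelve_of_caps`, modulo `s₃ ≤ 7 ∧ s₄ ≤ 29` at corank `5` and `s₄ ≤ 45` at corank `6`). This module
replaces the three cap hypotheses by ONE: the cell `(12, 6)` is unconditional (`c025_core_twelve_six`, S1CellTwelveSixUncond: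
LEMMA P's `s₃ ≤ 10` + p1's unconditional `s₄ ≤ 57`), the triangle half of the corank-`5` cap is LEMMA P's theorem
`s₃ ≤ 7` (`core_ncard_triangles_le_seven_of_nullity_five`, S1TriangleFive), and the four-circuit half is WEAKENED
from `29` to `32` — the exact-integer twin (mining/p2/g19/needs.py) reads `cellOK10 12 5 7 32` at `0.9965` and
`cellOK10 12 5 7 33` at `1.0004`: the unconditional table (`33`, S1CoreCapUncond) misses the cell by `0.04 %`, and
ANY of `s₄ ≤ 32` / `s₅ ≤ 124` / a per-point bound `Q*(5) ≤ 14` (⇒ `s₄ ≤ 18 + 14 = 32` by p3's recursion on p1's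
kernel table) closes the row. So: **`q = 4` holds for every `p ≥ 12` modulo «every `e`-free core of nullity `5` has
at most `32` four-circuits»** (true by the computed `Q*(5) = 11`, which gives `29`).

* `cell_twelve_five_cap32` — `cellOK10 12 5 7 32 = true` (decide + kernel);
* **`c025_core_four_twelve_of_cap32`**, **`c025_four_twelve_fixed_of_cap32`**, **`c025_four_twelve_of_cap32`**.
Axioms: standard (the cap is a hypothesis).
-/

open scoped Matroid

namespace PercRepro

namespace S1

open Set

variable {α : Type}

/-- The capped cell `(12, 5)` with `s₃ ≤ 7` and `s₄ ≤ 32`, by kernel. -/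
theorem cell_twelve_five_cap32 : cellOK10 12 5 7 32 = true := by decide +kernel

/-- **THE CORE OF RANK `12` MODULO THE SINGLE CAP `s₄ ≤ 32` AT CORANK `5`**: `(12, 5)` with LEMMA P's `s₃ ≤ 7`,
`(12, 6)` unconditional, `(12, 7)` and `(12, 8)` the sub-case cells, `d ≥ 9` by `cellOK8`. -/
theorem c025_core_four_twelve_of_cap32 (M : Matroid α) [M.Finite] (hR : M.eRank = (12 : ℕ)) (hbig : 12 + 4 < M.E.ncard)
    (hfree : ∀ e ∈ M.E, ∃ A ⊆ M.E \ {e}, e ∉ M.closure A ∧ e ∉ M.closure ((M.E \ {e}) \ A))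
    (hcap5 : M.E.ncard = 17 → {C : Set α | M.IsCircuit C ∧ C.ncard = 4}.ncard ≤ 32) :
    ThmN.RLS M 12 4 := by
  set d := M.E.ncard - 12 with hd
  have hn : M.E.ncard = 12 + d := by omega
  have hdd : M.E.encard = M.eRank + d := by
    rw [hR, ← M.ground_finite.cast_ncard_eq, hn]
    push_cast
    ring
  rcases Nat.lt_or_ge d 6 with h5 | h6
  · -- `d = 5`: the capped cell `(12, 5)` — `s₃ ≤ 7` is LEMMA P, `s₄ ≤ 32` the hypothesis
    have hd5 : d = 5 := by omega
    have hd5' : M.E.encard = M.eRank + ((5 : ℕ) : ℕ∞) := by rw [hdd, hd5]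
    have hP := core_ncard_triangles_le_seven_of_nullity_five M hfree hd5'
    have hS := hcap5 (by omega)
    exact rls_of_cellOK10 M 12 d 7 32 (by omega) hR hn hfree hP hS (by norm_num) (hd5 ▸ cell_twelve_five_cap32)
  rcases Nat.lt_or_ge d 7 with h6' | h7
  · exact c025_core_twelve_six M hR (by omega) hfree
  rcases Nat.lt_or_ge d 8 with h7' | h8
  · exact c025_core_twelve_seven M hR (by omega) hfree
  rcases Nat.lt_or_ge d 9 with h8' | h9
  · exact c025_core_twelve_eight M hR (by omega) hfree
  rcases Nat.lt_or_ge d 401 with h401 | h401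
  · exact rls_of_cellOK8 M 12 d (by omega) hR hn hfree (by norm_num) (table_12_9_400 d h401 h9)
  · exact rls_of_cellOK8 M 12 d (by omega) hR hn hfree (by norm_num) (cellOK8_of_tail12 d h401)

/-- **LEVEL `4` AT RANK `12`, MODULO `s₄ ≤ 32` ON THE CORES OF NULLITY `5`** (the fixed-rank frame). -/
theorem c025_four_twelve_fixed_of_cap32
    (hcap5 : ∀ (N : Matroid α) [N.Finite],
      (∀ e ∈ N.E, ∃ A ⊆ N.E \ {e}, e ∉ N.closure A ∧ e ∉ N.closure ((N.E \ {e}) \ A)) →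
      N.E.encard = N.eRank + ((5 : ℕ) : ℕ∞) → {C : Set α | N.IsCircuit C ∧ C.ncard = 4}.ncard ≤ 32)
    (M : Matroid α) [M.Finite] : ThmN.RLS M 12 4 := by
  refine rls_succ_fixed (α := α) 3 4 12 (by omega) ?_ ?_ ?_ M
  · intro M' _
    exact SevenThree.c025_three_all M' 11 (by omega)
  · intro M' _ hn
    rcases Nat.lt_or_ge M'.E.ncard (12 + 4) with h | h
    · exact ThmN.RLS_of_ncard_lt M' h
    · exact ThmN.RLS_of_ncard_eq M' (by omega)
  · intro M' _ hR hbig hfree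
    refine c025_core_four_twelve_of_cap32 M' hR hbig hfree ?_
    intro h17
    refine hcap5 M' hfree ?_
    rw [hR, ← M'.ground_finite.cast_ncard_eq, h17]
    push_cast
    ring

/-- **C-025 AT LEVEL `4` FOR EVERY `p ≥ 12`, MODULO `s₄ ≤ 32` ON THE CORES OF NULLITY `5`** (`p ≥ 13` is phase 9:
`c025_four_thirteen`). -/
theorem c025_four_twelve_of_cap32
    (hcap5 : ∀ (N : Matroid α) [N.Finite],
      (∀ e ∈ N.E, ∃ A ⊆ N.E \ {e}, e ∉ N.closure A ∧ e ∉ N.closure ((N.E \ {e}) \ A)) →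
      N.E.encard = N.eRank + ((5 : ℕ) : ℕ∞) → {C : Set α | N.IsCircuit C ∧ C.ncard = 4}.ncard ≤ 32)
    (M : Matroid α) [M.Finite] (p : ℕ) (hp : 12 ≤ p) : ThmN.RLS M p 4 := by
  rcases Nat.lt_or_ge p 13 with h | h
  · have hp12 : p = 12 := by omega
    subst hp12
    exact c025_four_twelve_fixed_of_cap32 hcap5 M
  · exact c025_four_thirteen M p h

end S1

end PercRepro
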